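import Summits.CriticalPhenomena.PercolationContinuityZ3.Theorems.SahiMasterFamilyLocalToGlobalAlpha

/-!
# (α) for the GLUED frame field, at every order — hence LG_5, (TT_5) and `MasterFamilyIdentEqIff 5`

Unit `prim-master-conj` (crux anchor stmt-CriticalPhenomena-4575), gen 12; memo HOME/prim-master-conj/TIGHTNESS-IV.md §4.
Setting of `LocalToGlobal` / `AlphaGlued` (glued frames with pairwise disjoint supports, structured contraction faces, structured and consistent
deletion faces at the core-free coordinates, a core-free coordinate, `≥ 2` coordinates).  THEOREM (α_glued), every order:

  **`two_le_card_pureFail_gann`**: every configuration of a glued annihilator `gann y` lies outside at least two PURE members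
  (members with empty glued annihilator).

Proof (a refinement of gen 11's `two_le_card_pure`).  Let `χ ∈ gann y` fail at most one pure member.  Shrink `χ` to `θ := χ ∩ T`, `T` = the
glued block of `y` ∪ the supports of the pure members: still in `gann y`, same pure failures, and now `θ` MISSES every glued block of a non-pure
member `≠ y`.  KEY: every such bad `θ ⊆ T` contains every core-free coordinate `f` — otherwise the deletion face at `f` (structured, consistent)
has, by (α) for structured families (`exists_two_pure_not_mem`), two face-pure members failing at `θ`, one of them globally non-pure, hence an
OWNER `c` of `f` (`f` in the glued block of `c`, `mem_esupp_of_pure_in_faceF`); every vertex of `gframe c` is again missed by `θ`, so owned by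
the same `c`, so contained in every point of `gann c` — and the vertex lemma empties the vertex set of `gframe c`, contradicting `f`.  With KEY:
the vertices of `gframe y` are all pivotal at `θ` (removing one keeps a bad point inside `T`), so `gframe y` has no vertex; a core-free `f₀ ∈ θ`
then lies in a pure block `S_q`; if `q` fails at `χ` remove `f₀` (still bad, misses `f₀`); if not, every vertex of `U q` is pivotal at `θ` and the
vertex lemma empties `verts (U q) ∋ f₀`.  Contradiction.

Consequences (all kernel-checked here): `alphaGlued_holds : ∀ n, AlphaGlued n`; **`localToGlobal_one : LocalToGlobal 1`** (LG_5);
**`terminalTight_two : TerminalTight 2`** ((TT_5)); and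

  **`masterFamilyIdentEqIff_five : MasterFamilyIdentEqIff 5`** — for increasing events `U₁,…,U₅` on a finite product of two-point spaces,
  `E₅(μ_p; 1_{U₁},…,1_{U₅}) = 0` for every `p` in the open cube iff `(U₁,…,U₅) ∈ Z₅`.

Also, at every order: the local-to-global step holds whenever at most two members are pure or at most two are non-pure
(`localToGlobal_of_card`).  Pure combinatorics on top of gens 6–12; axioms standard. [this work]
-/

noncomputable section

open scoped Classical

namespace Summit.CriticalPhenomena.PercolationContinuityZ3.Theorems

namespace GluedFrames

open Finset Function
open Literature.Probability.LatticeModels.Kahn2022 (Affects)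

variable {ι : Type*} [Fintype ι] {κ : Type*} (U : κ → Set (Set ι)) (W : Finset κ)

/-! ### Owners of core-free coordinates missed by a bad point -/

section Alpha

variable {U W}

/-- Standing hypotheses of the glued setting (those of `two_le_card_pure`). [this work] -/
structure GluedSetting (U : κ → Set (Set ι)) (W : Finset κ) : Prop where
  hU : ∀ k, IsUpperSet (U k)
  hne : ∀ k, (U k).Nonempty
  hWU : ∀ k, k ∈ W
  hS : ∀ h, Structured (faceT U h) W
  hd : ∀ w ∈ W, ∀ w' ∈ W, w ≠ w' → Disjoint (esupp (gframe U W w)) (esupp (gframe U W w'))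
  hF : ∀ f, CoreFree U f → Structured (faceF U f) W ∧ FaceFConsistent U W f
  hι : ∀ f : ι, ∃ h, h ≠ f

namespace GluedSetting

variable (G : GluedSetting U W)
include G

/-- The vertices of a glued frame are exactly the core-free coordinates of its block. [this work] -/
theorem mem_verts_gframe_iff {w : κ} {f : ι} : f ∈ verts (gframe U W w) ↔ CoreFree U f ∧ f ∈ esupp (gframe U W w) :=
  ⟨fun h => ⟨coreFree_of_mem_verts U W G.hU G.hne G.hS G.hd G.hWU G.hι (G.hWU w) h, (mem_verts.1 h).1⟩,
    fun h => mem_verts_gframe_of_coreFree U W G.hU h.1 h.2⟩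

/-- A pure member is its glued frame. [this work] -/
theorem gframe_eq_of_pure {q : κ} (hq : gann U W q = ∅) : gframe U W q = U q := (gann_eq_empty_iff U W G.hU q).1 hq

/-- **Owner lemma.**  If `θ ∈ gann y` fails at most the pure members failing at `χ`, at most one pure member fails at `χ`, and `θ` misses the
core-free coordinate `f`, then some globally NON-pure member `c ≠ y` failing at `θ` is pure in the deletion face at `f`; in particular `f` lies
in the glued block of `c`. [this work] -/
theorem exists_owner {y : κ} {χ θ : Set ι} (hθ : θ ∈ gann U W y)
    (hθP : ∀ q ∈ W, gann U W q = ∅ → θ ∉ U q → χ ∉ U q)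
    (hχ : ((W.filter fun p => gann U W p = ∅).filter fun p => χ ∉ U p).card ≤ 1)
    {f : ι} (hf : CoreFree U f) (hfθ : f ∉ θ) :
    ∃ c ∈ W, c ≠ y ∧ (gann U W c).Nonempty ∧ θ ∉ U c ∧ cframe (faceF U f) W c ⊆ faceF U f c := by
  obtain ⟨hFs, hFc⟩ := G.hF f hf
  have hΦU : ∀ k, IsUpperSet (faceF U f k) := isUpperSet_faceF U G.hU f
  have hΦne : ∀ k, (faceF U f k).Nonempty := faceF_nonempty U hf
  have hA : θ ∈ cframe (faceF U f) W y := by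
    rw [hFc y (G.hWU y), mem_secAt_false_iff_of_notMem hfθ]; exact hθ.1
  have hUθ : θ ∉ faceF U f y := by
    rw [faceF_apply, mem_secAt_false_iff_of_notMem hfθ]; exact hθ.2
  obtain ⟨a, ha, b, hb, hab, hay, hby, hfa, hfb, hθa, hθb⟩ :=
    exists_two_pure_not_mem (faceF U f) hΦU hΦne hFs (G.hWU y) hA hUθ
  rw [faceF_apply, mem_secAt_false_iff_of_notMem hfθ] at hθa hθb
  -- not both `a` and `b` are globally pure (at most one pure member fails at `χ`)
  have hnot : ¬ (gann U W a = ∅ ∧ gann U W b = ∅) := by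
    rintro ⟨hpa, hpb⟩
    have hsub : ({a, b} : Finset κ) ⊆ (W.filter fun p => gann U W p = ∅).filter fun p => χ ∉ U p := by
      intro c hc
      rw [mem_filter, mem_filter]
      rcases mem_insert.1 hc with rfl | hc
      · exact ⟨⟨ha, hpa⟩, hθP _ ha hpa hθa⟩
      · rw [mem_singleton] at hc; subst hc; exact ⟨⟨hb, hpb⟩, hθP _ hb hpb hθb⟩
    have := (card_le_card hsub).trans hχ
    rw [card_pair hab] at this
    omega
  by_cases hpa : gann U W a = ∅
  · exact ⟨b, hb, hby, Set.nonempty_iff_ne_empty.2 fun h => hnot ⟨hpa, h⟩, hθb, hfb.le⟩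
  · exact ⟨a, ha, hay, Set.nonempty_iff_ne_empty.2 hpa, hθa, hfa.le⟩

/-- **KEY: a bad point inside `T` contains every core-free coordinate.**  Here `T` = the glued block of `y` together with the supports of the pure
members, "bad" = at most one pure member fails at `χ` and the pure failures of `θ` are among those of `χ`. [this work] -/
theorem mem_of_bad {y : κ} {χ θ : Set ι} (hθ : θ ∈ gann U W y)
    (hθT : θ ⊆ ↑(esupp (gframe U W y)) ∪ ⋃ q ∈ W.filter (fun p => gann U W p = ∅), (↑(esupp (U q)) : Set ι))
    (hθP : ∀ q ∈ W, gann U W q = ∅ → θ ∉ U q → χ ∉ U q)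
    (hχ : ((W.filter fun p => gann U W p = ∅).filter fun p => χ ∉ U p).card ≤ 1)
    {f : ι} (hf : CoreFree U f) : f ∈ θ := by
  by_contra hfθ
  obtain ⟨c, hc, hcy, hcN, hθc, hcpure⟩ := G.exists_owner hθ hθP hχ hf hfθ
  have hfc : f ∈ esupp (gframe U W c) := mem_esupp_of_pure_in_faceF U W G.hU (G.hF f hf).2 hc hcpure hcN
  -- the glued block of `c` misses `T`, hence `θ`
  have hcT : ∀ g ∈ esupp (gframe U W c), g ∉ θ := by
    intro g hg hgθ
    rcases hθT hgθ with h | h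
    · exact Finset.disjoint_left.1 (G.hd c hc y (G.hWU y) hcy) hg (mem_coe.1 h)
    · rw [Set.mem_iUnion₂] at h
      obtain ⟨q, hq, hgq⟩ := h
      rw [mem_filter] at hq
      have hcq : c ≠ q := fun e => hcN.ne_empty (e ▸ hq.2)
      have := G.hd c hc q hq.1 hcq
      rw [G.gframe_eq_of_pure hq.2] at this
      exact Finset.disjoint_left.1 this hg (mem_coe.1 hgq)
  -- every vertex of `gframe c` is owned by `c`: all points of `gann c` contain it
  have hV : ∀ ψ ∈ gann U W c, ↑(verts (gframe U W c)) ⊆ ψ := by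
    intro ψ hψ g hg
    obtain ⟨hgcf, hgc⟩ := G.mem_verts_gframe_iff.1 (mem_coe.1 hg)
    obtain ⟨c', hc', -, hc'N, -, hc'pure⟩ := G.exists_owner hθ hθP hχ hgcf (hcT g hgc)
    have hgc' : g ∈ esupp (gframe U W c') := mem_esupp_of_pure_in_faceF U W G.hU (G.hF g hgcf).2 hc' hc'pure hc'N
    have hcc' : c' = c := by
      by_contra hne'
      exact Finset.disjoint_left.1 (G.hd c' hc' c hc hne') hgc' hgc
    subst hcc'
    exact forall_mem_of_pure_in_faceF U W (G.hF g hgcf).2 hc' hc'pure hψ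
  have hempty := verts_eq_empty_of_downClosed (isUpperSet_gframe U W G.hU c) (fun ψ hψ => hψ.1) hcN
    (fun ψ hψ ψ' hle hψ' => mem_gann_of_subset U W G.hU hψ hle hψ') hV
  have : f ∈ verts (gframe U W c) := mem_verts_gframe_of_coreFree U W G.hU hf hfc
  rw [hempty] at this
  exact notMem_empty f this

/-- **THEOREM (α_glued), every order: a configuration of a glued annihilator lies outside at least two pure members** — provided some
coordinate is core-free. [this work] -/
theorem two_le_card_pureFail_gann (hE0 : ∃ f, CoreFree U f) {y : κ} {χ : Set ι} (hχ : χ ∈ gann U W y) :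
    2 ≤ ((W.filter fun p => gann U W p = ∅).filter fun p => χ ∉ U p).card := by
  by_contra hlt
  push Not at hlt
  have hχ1 : ((W.filter fun p => gann U W p = ∅).filter fun p => χ ∉ U p).card ≤ 1 := by omega
  have hU := G.hU
  set Sy : Set ι := ↑(esupp (gframe U W y)) with hSydef
  set SP : Set ι := ⋃ q ∈ W.filter (fun p => gann U W p = ∅), (↑(esupp (U q)) : Set ι) with hSPdef
  -- pure supports miss the glued block of `y` and each other's
  have hqy : ∀ q ∈ W, gann U W q = ∅ → ∀ g ∈ esupp (U q), g ∉ esupp (gframe U W y) := by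
    intro q hq hpq g hg hgy
    have hqy' : q ≠ y := by rintro rfl; exact hχ.2 (by rw [← G.gframe_eq_of_pure hpq]; exact hχ.1)
    have := G.hd q hq y (G.hWU y) hqy'
    rw [G.gframe_eq_of_pure hpq] at this
    exact Finset.disjoint_left.1 this hg hgy
  have hqq : ∀ q ∈ W, gann U W q = ∅ → ∀ q' ∈ W, gann U W q' = ∅ → q ≠ q' → ∀ g ∈ esupp (U q), g ∉ esupp (U q') := by
    intro q hq hpq q' hq' hpq' hne' g hg hg'
    have := G.hd q hq q' hq' hne'
    rw [G.gframe_eq_of_pure hpq, G.gframe_eq_of_pure hpq'] at this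
    exact Finset.disjoint_left.1 this hg hg'
  -- the shrunk bad point `θ₀ := χ ∩ T`
  set θ₀ : Set ι := χ ∩ (Sy ∪ SP) with hθ₀def
  have hθ₀T : θ₀ ⊆ Sy ∪ SP := Set.inter_subset_right
  have htrace : ∀ {A : Set (Set ι)}, IsUpperSet A → ↑(esupp A) ⊆ Sy ∪ SP → (θ₀ ∈ A ↔ χ ∈ A) := by
    intro A hA hAT
    refine mem_iff_of_inter_esupp_eq hA ?_
    ext g; constructor
    · rintro ⟨⟨hg, -⟩, hgA⟩; exact ⟨hg, hgA⟩
    · rintro ⟨hg, hgA⟩; exact ⟨⟨hg, hAT hgA⟩, hgA⟩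
  have hSPq : ∀ q ∈ W, gann U W q = ∅ → ↑(esupp (U q)) ⊆ Sy ∪ SP := fun q hq hpq g hg =>
    Or.inr (Set.mem_biUnion (mem_filter.2 ⟨hq, hpq⟩) hg)
  have hθ₀ : θ₀ ∈ gann U W y :=
    ⟨(htrace (isUpperSet_gframe U W hU y) Set.subset_union_left).2 hχ.1, fun h => hχ.2 (hU y Set.inter_subset_left h)⟩
  have hθ₀P : ∀ q ∈ W, gann U W q = ∅ → θ₀ ∉ U q → χ ∉ U q :=
    fun q hq hpq h hχq => h ((htrace (hU q) (hSPq q hq hpq)).2 hχq)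
  -- removing from `θ₀` a coordinate not read by `gframe y` keeps a point of `gann y` inside `T`
  have hremove : ∀ {g : ι}, g ∉ esupp (gframe U W y) → θ₀ \ {g} ∈ gann U W y := fun {g} hg =>
    ⟨diff_singleton_mem_of_not_affects (isUpperSet_gframe U W hU y) (fun h => hg (mem_esupp.2 h)) hθ₀.1,
      fun h => hθ₀.2 (hU y Set.sdiff_subset h)⟩
  have hsubT : ∀ g, θ₀ \ {g} ⊆ Sy ∪ SP := fun g => Set.sdiff_subset.trans hθ₀T
  -- (i) `gframe y` has no vertex
  have hVy : verts (gframe U W y) = ∅ := by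
    refine verts_eq_empty_of_pivotal (isUpperSet_gframe U W hU y) hθ₀.1 (fun f hf => ?_) (fun f hf hmem => ?_)
    · exact G.mem_of_bad hθ₀ hθ₀T hθ₀P hχ1 (G.mem_verts_gframe_iff.1 (mem_coe.1 hf)).1
    · obtain ⟨hfcf, hfy⟩ := G.mem_verts_gframe_iff.1 hf
      have hθ' : θ₀ \ {f} ∈ gann U W y := ⟨hmem, fun h => hθ₀.2 (hU y Set.sdiff_subset h)⟩
      have hθ'P : ∀ q ∈ W, gann U W q = ∅ → θ₀ \ {f} ∉ U q → χ ∉ U q := by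
        intro q hq hpq h
        refine hθ₀P q hq hpq fun h0 => h ?_
        exact diff_singleton_mem_of_not_affects (hU q) (fun ha => hqy q hq hpq f (mem_esupp.2 ha) hfy) h0
      exact ((G.mem_of_bad hθ' (hsubT f) hθ'P hχ1 hfcf).2 rfl).elim
  -- (ii) a core-free coordinate lies in `θ₀`, not in the block of `y`, hence in a pure support `S_q`
  obtain ⟨f₀, hf₀⟩ := hE0
  have hf₀θ : f₀ ∈ θ₀ := G.mem_of_bad hθ₀ hθ₀T hθ₀P hχ1 hf₀
  have hf₀y : f₀ ∉ esupp (gframe U W y) := fun h => by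
    have := mem_verts_gframe_of_coreFree U W hU hf₀ h
    rw [hVy] at this; exact notMem_empty _ this
  obtain ⟨q, hq, hpq, hf₀q⟩ : ∃ q ∈ W, gann U W q = ∅ ∧ f₀ ∈ esupp (U q) := by
    rcases hθ₀T hf₀θ with h | h
    · exact absurd (mem_coe.1 h) hf₀y
    · rw [Set.mem_iUnion₂] at h
      obtain ⟨q, hq, hg⟩ := h
      rw [mem_filter] at hq
      exact ⟨q, hq.1, hq.2, mem_coe.1 hg⟩
  by_cases hχq : χ ∈ U q
  · -- `q` does not fail: every vertex of `U q` is pivotal at `θ₀`, so `U q` has no vertex — but `f₀` is one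
    have hθ₀q : θ₀ ∈ U q := (htrace (hU q) (hSPq q hq hpq)).2 hχq
    have hVq : verts (U q) = ∅ := by
      refine verts_eq_empty_of_pivotal (hU q) hθ₀q (fun f hf => ?_) (fun f hf hmem => ?_)
      · have hf' : f ∈ verts (gframe U W q) := by rw [G.gframe_eq_of_pure hpq]; exact mem_coe.1 hf
        exact G.mem_of_bad hθ₀ hθ₀T hθ₀P hχ1 (G.mem_verts_gframe_iff.1 hf').1
      · have hf' : f ∈ verts (gframe U W q) := by rw [G.gframe_eq_of_pure hpq]; exact hf
        obtain ⟨hfcf, hfq⟩ := G.mem_verts_gframe_iff.1 hf'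
        rw [G.gframe_eq_of_pure hpq] at hfq
        have hθ' := hremove (hqy q hq hpq f hfq)
        have hθ'P : ∀ q' ∈ W, gann U W q' = ∅ → θ₀ \ {f} ∉ U q' → χ ∉ U q' := by
          intro q' hq' hpq' h
          by_cases hqq' : q = q'
          · subst hqq'; exact absurd hmem h
          · refine hθ₀P q' hq' hpq' fun h0 => h ?_
            exact diff_singleton_mem_of_not_affects (hU q') (fun ha => hqq q hq hpq q' hq' hpq' hqq' f hfq (mem_esupp.2 ha)) h0
        exact ((G.mem_of_bad hθ' (hsubT f) hθ'P hχ1 hfcf).2 rfl).elim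
    have : f₀ ∈ verts (U q) := mem_verts.2 ⟨hf₀q, hf₀ q⟩
    rw [hVq] at this
    exact notMem_empty _ this
  · -- `q` fails at `χ`: remove `f₀`; the result is still bad and misses the core-free `f₀`
    have hθ' := hremove hf₀y
    have hθ'P : ∀ q' ∈ W, gann U W q' = ∅ → θ₀ \ {f₀} ∉ U q' → χ ∉ U q' := by
      intro q' hq' hpq' h
      by_cases hqq' : q = q'
      · subst hqq'; exact hχq
      · refine hθ₀P q' hq' hpq' fun h0 => h ?_
        exact diff_singleton_mem_of_not_affects (hU q') (fun ha => hqq q hq hpq q' hq' hpq' hqq' f₀ hf₀q (mem_esupp.2 ha)) h0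
    exact (G.mem_of_bad hθ' (hsubT f₀) hθ'P hχ1 hf₀).2 rfl

end GluedSetting

end Alpha

/-! ### (α_glued), LG_5, (TT_5), (EQI-5) -/

/-- **(α) holds at every order.** [this work] -/
theorem alphaGlued_holds (n : ℕ) : AlphaGlued n := by
  intro ι _ U hU hne hns hS hd hF hE0 hι habs y χ hχ
  have hd' : ∀ x ∈ (univ : Finset (Fin (n + 4))), ∀ x' ∈ (univ : Finset (Fin (n + 4))), x ≠ x' →
      Disjoint (esupp (gframe U univ x)) (esupp (gframe U univ x')) := fun x _ x' _ h => hd x x' h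
  have G : GluedSetting U univ :=
    { hU := hU, hne := hne, hWU := mem_univ, hS := hS, hd := hd', hι := hι,
      hF := fun f hf => ⟨hF f hf, faceFConsistent_of_noAbsorber U univ hU hne hns hS hd'
        (fun l _ => by obtain ⟨m, hm, h⟩ := habs l; exact ⟨m, mem_univ m, hm, h⟩) (by simp) hf (hF f hf)⟩ }
  exact G.two_le_card_pureFail_gann hE0 hχ

/-- **THEOREM LG5: the local-to-global step at order five.** [this work] -/
theorem localToGlobal_one : LocalToGlobal 1 := localToGlobal_one_of_alphaGlued (alphaGlued_holds 1)

/-- **(TT_5): terminal quintuples are tight.** [this work] -/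
theorem terminalTight_two : TerminalTight 2 := terminalTight_of_localToGlobal 1 localToGlobal_one

/-- **THE IDENTICALLY-ZERO MASTER CONJECTURE AT ORDER FIVE.**  For increasing events `U₁,…,U₅` on a finite product of two-point spaces,
`E₅(μ_p; 1_{U₁},…,1_{U₅}) = 0` for every `p` in the open cube iff `(U₁,…,U₅) ∈ Z₅`. [this work] -/
theorem masterFamilyIdentEqIff_five : MasterFamilyIdentEqIff 5 := masterFamilyIdentEqIff_five_of_alphaGlued (alphaGlued_holds 1)

/-- **LG_k at every order whenever `|P| = 2` or `|N| = 2`** (two pure members, or two non-pure members). [this work] -/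
theorem localToGlobal_of_card (n : ℕ) (ι : Type) [Fintype ι] (U : Fin (n + 4) → Set (Set ι)) (hU : ∀ k, IsUpperSet (U k))
    (hne : ∀ k, (U k).Nonempty) (hns : ∀ k, U k ≠ Set.univ) (hS : ∀ h, Structured (faceT U h) univ)
    (hd : ∀ x x', x ≠ x' → Disjoint (esupp (gframe U univ x)) (esupp (gframe U univ x')))
    (hF : ∀ f, CoreFree U f → Structured (faceF U f) univ) (hE0 : ∃ f, CoreFree U f) (hι : ∀ f : ι, ∃ h, h ≠ f)
    (habs : ∀ l, ∃ m, m ≠ l ∧ ¬ U m ⊆ U l) (hdel : ∀ x, ¬ Structured U (univ.erase x))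
    (hPN : (univ.filter fun p : Fin (n + 4) => gann U univ p = ∅).card = 2 ∨
      (univ.filter fun p : Fin (n + 4) => gann U univ p ≠ ∅).card = 2) : False :=
  false_of_alpha U hU hne hd (fun x hs => hdel x (by convert hs using 2)) (by simp)
    (alphaGlued_holds n ι U hU hne hns hS hd hF hE0 hι habs) hPN

end GluedFrames

end Summit.CriticalPhenomena.PercolationContinuityZ3.Theorems
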